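import Literature.NumberTheory.EllipticCurves.Kato2004.MainConjecturePrimeTDoor
import Literature.NumberTheory.EllipticCurves.Kim2025.FineMainIdentityOffP
import Literature.NumberTheory.EllipticCurves.NonEisensteinPrimeOfSurjective
import HarnessLib

/-!
# Kato 2004 Conj. 12.10 at `𝔭 = (T)` for `T_pW` at a DOOR PRIME — the printed proof
# (Burungale–Castella–Skinner 2025 Thm. 1.1.2 (a) + Kato §17.13, p. 280 + (14.9.1) + Imai 1975)
# ASSEMBLED IN THE KERNEL for the cyclotomic pair in the cyclotomic variable, MODULO the tree's
# named facts and ONE typed missing clause (proofs only; companion of `MainConjecturePrimeTDoor.lean`)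

Topic `NumberTheory/EllipticCurves`, sub-directory `Kato2004` (namespace = path). Seat
`bsd-input-kato-primet-lead` (literature-prover, LEAD; input `kato_mainConjecture_primeT_of_door` of
stmt-BirchSwinnertonDyer-23168 = stub L2b of crux `DerivedKatoDoor`, route `DerivedKatoValuationDoor`).
THEOREMS ONLY: no `def`, no named fact, no `instance`, no notation, no `sorry`. HONEST FRAMING: this
file does NOT prove `kato_mainConjecture_primeT_of_door` (the named fact stays a `def … : Prop`,
untouched); it proves the fact's CONCLUSION for every cyclotomic pair `(K, γ)` IN THE CYCLOTOMIC
VARIABLE (`IsCyclotomicVariable p γ`, the normalisation under which the tree states BCS and Kato's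
§17.13 package), from explicit hypotheses each of which is either a tree NAMED FACT passed by name
or the ONE missing printed clause spelled out in full (X below). Proving this makes nothing
unconditional by itself; no summit statement (BirchSwinnertonDyer) is proved or advanced here.

## The printed proof and where each step lives

At a door prime (`5 ≤ p` good ordinary, `ρ̄_{E,p}` onto, so `E[p]` irreducible —
`hasIrreducibleModPGaloisRep_of_hasSurjectiveModNGaloisRep`), for the cyclotomic `ℤ_p`-extension
`K` with topological generator `γ` in the cyclotomic variable, a pinned `I : IwasawaH1Data W p K γ`
(`𝐇¹_Γ(T_pW)`), the constructed duals `D = W.selmerDualData K hγ` (`X(E/ℚ_∞)`) and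
`Y = W.fineSelmerDualData K hγ` (`X₀(E/ℚ_∞)`), and an ADMISSIBLE Kato zeta class `z₀ ∈ I.H`
(`IsAdmissibleZetaClass`: `Λ z₀ = Λ·𝐳_{γ_W}`, the `Δ`-trivial component of Kato's `Z(f, T_pW)`):

1. **BCS Thm. 1.1.2 (a)** `ch_Λ X(E/ℚ_∞) = (L_p(E/ℚ))` in `Λ ⊗ ℚ_p` — tree NAMED FACT
   `burungale_castella_skinner_charIdeal_eq_padicLFunction` (hypothesis `hBCS`).
2. **Kato §17.13 (17.13.1)–(17.13.4), Prop. 17.11, p. 280** on the package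
   `K : Kato2004.DivisibilityInputs W p f K γ I D` WITH the fine quotient `π : D.X ↠ Y.X` exact after
   `P → X` ((14.9.3)): `ℓ_𝔭(𝐇¹_Γ/K.Z) = ℓ_𝔭(Y)` at every height-one `𝔭 ∌ p`, in particular at
   `𝔭 = (T)` — tree THEOREM `Kim2025.fine_offP_of_bcs` (C.-H. Kim, arXiv:2505.09121 Thm. 3.19, "equivalent
   via the global Poitou–Tate duality", PROVED in the tree over the package from `hBCS`).
3. **Kato Thm. 12.6 with Thm. 12.5 (1)(4) and §13.9–13.12** — «`Z ⊂ Z(f,T)` and `Z(f,T)/Z` is a finite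
   group» [Thm. 12.6, p. 222], and on the `Δ`-trivial component `Z(f, T_pW) = Λ·𝐳_{γ_W} = Λ z₀`
   for an admissible `z₀` [Thm. 12.5 (1) p. 221 (linearity of `γ ↦ z_γ`), (A6′) of
   `Kato2004/AdmissibleZetaClass.lean` with Lemma 13.10 (1) p. 230]: HENCE at every height-one prime
   `𝔭` of `Λ`, **`(K.Z)_𝔭 = (Λ z₀)_𝔭`**, i.e. some `s ∉ 𝔭` has `s·z₀ ∈ K.Z` and `s·K.Z ⊆ Λ z₀`.
   THIS CLAUSE IS NOT IN THE TREE: the package's `Z` is abstract, bounded above only by the span of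
   arbitrary Euler-system classes (`exists_divisibilityInputsZetaLine_fineQuotient_zeta`), and the
   tree's (C2) `exists_colemanMap_admissibleZeta` reads `ord_T L_p` off admissible classes through a
   SEPARATE existential map, not through the package's `col ∘ loc`. It is the hypothesis `hX` of this
   file, SPELLED OUT (no new `def`; D-0026): «the §17.13 package with fine quotient EXISTS together with
   the localisation clause for admissible classes» — `Kato2004.exists_divisibilityInputs_fineQuotient`
   verbatim plus clause 3 under `Irr(E[p])` (the lattice-homothety guard of the sibling fields
   `col_loc_mem_span` / `image_zeta_localized`). Typed as the «needs X» of this input (evidence note on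
   stmt-BirchSwinnertonDyer-23168). With it: `ℓ_T(𝐇¹_Γ/Λz₀) = ℓ_T(𝐇¹_Γ/K.Z)` (submodules agreeing
   after localisation have quotients of equal local length, `lengthAt_quotient_eq_of_localized_eq_submodule`).
4. **Kato (14.9.1) + (12.2.3) + (17.13.1) and Imai 1975**: Kato's `𝐇²_Γ(T_pW)` as a descent package
   `J : IwasawaH2Data W p K γ I` with the Poitou–Tate embedding `e : Y.X ↪ J.H2` of finite cokernel when
   `W(ℚ_{p,∞})[p^∞]` is finite — tree NAMED FACT `exists_iwasawaH2Data_fineSelmerDual_embedding`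
   (hypothesis `hH2`); the finiteness of `W(ℚ_{p,∞})[p^∞] = (W(ℚ̄)[p^∞])^{ker K ⊓ D_v}` at the good
   prime `p` (Imai, Proc. Japan Acad. 51 (1975), Theorem p. 12) is NOT a tree theorem for the LOCAL
   group (the tree proves the global `E(ℚ_∞)[p^∞]` finite, `finite_fixedPoints_kerSubgroup_geomPrimaryTorsion_of_ordinary`)
   and enters as the pointwise hypothesis `hfin`, in the exact currency of `hH2`. Then
   `ℓ_T(Y.X) = ℓ_T(J.H2)` (`lengthAt_eq_of_injective_of_finite_quotient`, `height_primeT`).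

Chaining 3, 2, 4: `ℓ_T(𝐇¹_Γ/Λz₀) = ℓ_T(𝐇¹_Γ/K.Z) = ℓ_T(X₀) = ℓ_T(𝐇²_Γ)` — Conj. 12.10 at `(T)`.

## What is here

* `lengthAt_quotient_eq_lengthAt_quotient_sup_submodule`, `lengthAt_quotient_eq_of_localized_eq_submodule`
  — submodules `N, N' ≤ M` with `s·N' ⊆ N`, `s·N ⊆ N'`, `s ∉ 𝔭` have `ℓ_𝔭(M/N) = ℓ_𝔭(M/N')`
  (the submodule form of `Kim2025.lengthAt_quotient_eq_of_localized_eq`).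
* `lengthAt_quotient_span_primeT_eq_fine_of_bcs` — step 3 + step 2 over ONE package: under `hBCS`,
  at a good ordinary `p ≥ 5` with `E[p]` irreducible, `(K, γ)` cyclotomic in the cyclotomic variable,
  for a package `K` with fine quotient `π : X ↠ Y` and a class `z₀` with `(K.Z)_{(T)} = (Λz₀)_{(T)}`:
  `ℓ_T(𝐇¹_Γ/Λz₀) = ℓ_T(Y)`.
* `lengthAt_quotient_span_primeT_eq_fineSelmerDual_of_inputs` — on the CONSTRUCTED `X₀(E/ℚ_∞)`, for
  every admissible `z₀`, at a door prime and a cyclotomic pair in the cyclotomic variable, from `hBCS`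
  and `hX`: `ℓ_T(𝐇¹_Γ/Λz₀) = ℓ_T(X₀(E/ℚ_∞))`; and its `≤` form
  `zetaQuotientLength_le_fineLength_of_inputs` — VERBATIM the conclusion of the consumer
  `Summit…DerivedKatoValuationDoor.stub_quotientLengthLeFineLength` / `zetaQuotientLengthLeFineLength_of_stub`
  at such pairs, WITHOUT `hH2` / Imai (the consumer's inequality needs neither `𝐇²` nor Imai).
* `kato_mainConjecture_primeT_of_door_of_isCyclotomicVariable` — VERBATIM the conclusion of
  `kato_mainConjecture_primeT_of_door` (`∃ J e, injective ∧ finite cokernel ∧ ∀ admissible z₀,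
  ℓ_T J.H2 = ℓ_T(𝐇¹_Γ/Λz₀)`) for every door prime, every cyclotomic `K`, every topological generator
  `γ` IN THE CYCLOTOMIC VARIABLE and every `I`, from `hBCS`, `hX`, `hH2` and the pointwise `hfin`.

## What is NOT here (the honest remainder of the input; REPAIR CENSUS in the seat's NOTES / HOME HANDOFF)

(N1) the clause X itself (a construction fact about Kato's genuine `Z`; print as in step 3);
(N2) the passage from the cyclotomic variable to an ARBITRARY cyclotomic `K` and topological generator
`γ` (the named fact quantifies over all of them): `K = u • κ₀`, `γ ≡ γ₀^w`, and `T ↦ (1+T)^w − 1` is an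
automorphism of `Λ` fixing `(T)` (Washington §13.2) — on the tree's pinned objects this is a transport
of `IwasawaH1Data` along equal layers, of `fineSelmerDualData` along equal kernels, of admissibility,
and of `ℓ_T` through `rank_{ℤ_p} M[T^n]`, none of which is in the tree for `𝐇¹_Γ` (it is for
`X(E/ℚ_∞)`: `IwasawaGeneratorChangeProofs.lean`); (N3) Imai's local finiteness at good `p` as a theorem.
With (N1)–(N3) the named fact follows from this file by instantiation.

## References

* K. Kato, *p-adic Hodge theory and values of zeta functions of modular forms*, Astérisque 295 (2004):
  Conj. 12.10 (p. 224), Thm. 12.5 (pp. 221–222), Thm. 12.6 (p. 222), §13.9–13.12 with Lemma 13.10 (1)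
  (pp. 229–231), (14.9.1) (p. 239), Prop. 17.11 (p. 277), §17.13 (17.13.1)–(17.13.4) and p. 280
  (pp. 279–280). [Kato2004Asterisque]
* A. Burungale, F. Castella, C. Skinner, *Base change and Iwasawa main conjectures for GL₂*, IMRN 2025
  (arXiv:2405.00270v2), Thm. 1.1.2 (a) (p. 2). [BurungaleCastellaSkinner2025]
* C.-H. Kim, arXiv:2505.09121v1 (2025), Thm. 3.19 and its proof (§3.5.3). [Kim2025RefinedTNC]
* H. Imai, Proc. Japan Acad. 51 (1975) 12–16, Theorem (p. 12). [Imai1975]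
* L. Washington, *Introduction to Cyclotomic Fields*, GTM 83, §13.2. [Washington1997]
* J. Neukirch, A. Schmidt, K. Wingberg, *Cohomology of Number Fields* (2008), Ch. V §1 (5.1.4) Remark 1.
  [NeukirchSchmidtWingberg2008]
* Tree: `Kato2004/MainConjecturePrimeTDoor.lean` (the named fact, its READING and DISCHARGE ROAD),
  `Kim2025/FineMainIdentityOffP.lean` (`fine_offP_of_bcs`), `Kim2025/MainIdentityAtAugmentationFineDictionary.lean`
  (`C_natCast_not_mem_primeT`), `Kato2004/DivisibilityInputs*.lean` (the §17.13 package),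
  `Kato2004/IwasawaH2FineSelmerDualComparison.lean` (`exists_iwasawaH2Data_fineSelmerDual_embedding`,
  `lengthAt_eq_of_injective_of_finite_quotient`), `Kato2004/AdmissibleZetaClass.lean`,
  `NonEisensteinPrimeOfSurjective.lean`, `KatoRankBoundProofs.lean` (`primeT`, `height_primeT`).
-/

noncomputable section

open scoped MatrixGroups ModularForm NumberField
open Field CongruenceSubgroup IsDedekindDomain
open Literature.NumberTheory.GaloisRepresentations
open Literature.NumberTheory.EllipticCurves Literature.NumberTheory.EllipticCurves.ModularForms
open Literature.NumberTheory.EllipticCurves.Module Literature.NumberTheory.EllipticCurves.IwasawaAlgebra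

universe u

namespace Literature.NumberTheory.EllipticCurves.Kato2004

/-! ## §1 Algebra: submodules that agree after localisation have quotients of equal local length -/

section Algebra

variable {R : Type*} [CommRing R] {M : Type*} [AddCommGroup M] [_root_.Module R M]

/-- If `s·N' ⊆ N` with `s ∉ 𝔭` then `ℓ_𝔭(M/N) = ℓ_𝔭(M/(N + N'))`: the kernel `(N + N')/N` of
`M/N ↠ M/(N + N')` is killed by `s`, hence dies at `𝔭`, and local length is additive (the submodule
form of `Kim2025.lengthAt_quotient_eq_lengthAt_quotient_sup`).
[cite: NeukirchSchmidtWingberg2008, Ch. V §1, (5.1.4) Remark 1] -/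
theorem lengthAt_quotient_eq_lengthAt_quotient_sup_submodule {N N' : Submodule R M} {s : R}
    (𝔭 : PrimeSpectrum R) (hs : s ∉ 𝔭.asIdeal) (hN' : ∀ x ∈ N', s • x ∈ N) :
    lengthAt R (M ⧸ N) 𝔭 = lengthAt R (M ⧸ (N ⊔ N')) 𝔭 := by
  set Q : Submodule R (M ⧸ N) := Submodule.map N.mkQ (N ⊔ N') with hQ
  have hexact := lengthAt_eq_add_of_exact Q.subtype Q.mkQ (Submodule.injective_subtype Q)
    (Submodule.mkQ_surjective Q) (LinearMap.exact_subtype_mkQ Q) 𝔭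
  have hQs : Module.IsTorsionBy R Q s := by
    rintro ⟨x, hx⟩
    obtain ⟨y, hy, rfl⟩ := Submodule.mem_map.mp hx
    obtain ⟨n, hn, n', hn', rfl⟩ := Submodule.mem_sup.mp hy
    apply Subtype.ext
    change s • N.mkQ (n + n') = 0
    rw [← map_smul, Submodule.mkQ_apply, Submodule.Quotient.mk_eq_zero, smul_add]
    exact N.add_mem (N.smul_mem s hn) (hN' n' hn')
  have hQ0 : lengthAt R Q 𝔭 = 0 := lengthAt_eq_zero_of_isTorsionBy hQs 𝔭 hs
  rw [hexact, hQ0, zero_add]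
  exact lengthAt_eq_of_linearEquiv (Submodule.quotientQuotientEquivQuotient N (N ⊔ N') le_sup_left) 𝔭

/-- **Submodules that agree after localisation at `𝔭` have quotients of the same local length**: if
`s ∉ 𝔭`, `s·N' ⊆ N` and `s·N ⊆ N'` then `ℓ_𝔭(M/N) = ℓ_𝔭(M/N')` (both equal `ℓ_𝔭(M/(N + N'))`;
`N_𝔭 = N'_𝔭` since `s` is a unit of `R_𝔭`). [cite: NeukirchSchmidtWingberg2008, Ch. V §1, (5.1.4) Remark 1] -/
theorem lengthAt_quotient_eq_of_localized_eq_submodule {N N' : Submodule R M} {s : R}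
    (𝔭 : PrimeSpectrum R) (hs : s ∉ 𝔭.asIdeal) (hN'N : ∀ x ∈ N', s • x ∈ N)
    (hNN' : ∀ x ∈ N, s • x ∈ N') :
    lengthAt R (M ⧸ N) 𝔭 = lengthAt R (M ⧸ N') 𝔭 := by
  rw [lengthAt_quotient_eq_lengthAt_quotient_sup_submodule 𝔭 hs hN'N,
    lengthAt_quotient_eq_lengthAt_quotient_sup_submodule 𝔭 hs hNN', sup_comm]

end Algebra

/-! ## §2 Steps 2–3 over ONE §17.13 package: `ℓ_T(𝐇¹_Γ/Λz₀) = ℓ_T(Y)` -/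

section Package

variable {p : ℕ} [Fact p.Prime] {W : WeierstrassCurve ℚ} [W.IsElliptic] [W.IsGloballyMinimal]
  [ContinuousSMul ℤ_[p] (W.tateModule p)] {N : ℕ} [NeZero N] {f : CuspForm (Gamma0 N) 2}
  {κ : ZpExtension ℚ p} {γ : absoluteGaloisGroup ℚ}
  {I : IwasawaH1Data W p κ γ} {D : W.SelmerDualData κ γ}
  {Y : Type u} [AddCommGroup Y] [_root_.Module (IwasawaAlgebra p) Y]

/-- A door prime is odd (private helper). [folklore] -/
private theorem ne_two_of_five_le (hp : 5 ≤ p) : p ≠ 2 := by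
  rintro rfl; omega

/-- **Kato §17.13 (p. 280) with BCS Thm. 1.1.2 (a) and the localisation `(K.Z)_{(T)} = (Λz₀)_{(T)}`
(Thm. 12.6 + Thm. 12.5 (1)(4)): `ℓ_T(𝐇¹_Γ/Λz₀) = ℓ_T(Y)`.** For `E/ℚ` (globally minimal `W`), a good
ordinary `p ≥ 5` with `E[p]` irreducible, the cyclotomic pair `(κ, γ)` in the cyclotomic variable,
a newform `f` of `W`, a §17.13 package `K` on `(I, D)` with fine quotient `π : X ↠ Y` exact after
`P → X`, and a class `z₀ ∈ 𝐇¹_Γ` such that some `s ∉ (T)` has `s·z₀ ∈ K.Z` and `s·K.Z ⊆ Λz₀`: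
`ℓ_T(I.H/Λz₀) = ℓ_T(Y)`. Step 2 is the tree theorem `Kim2025.fine_offP_of_bcs` at `𝔭 = (T)`
(`(T) ∌ p`), step 3 is `lengthAt_quotient_eq_of_localized_eq_submodule`.
[cite: Kato2004Asterisque, §17.13 (pp. 279–280), Thm. 12.6 (p. 222), Thm. 12.5 (1)(4) (pp. 221–222)]
[cite: BurungaleCastellaSkinner2025, Thm. 1.1.2 (a) (p. 2 of arXiv:2405.00270v2)]
[cite: Kim2025RefinedTNC, Thm. 3.19 and its proof (§3.5.3)] -/
theorem lengthAt_quotient_span_primeT_eq_fine_of_bcs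
    (hBCS : burungale_castella_skinner_charIdeal_eq_padicLFunction)
    (hp : 5 ≤ p) (hord : IsOrdinaryAt W p) (hirr : W.HasIrreducibleModPGaloisRep p)
    (hκ : κ.IsCyclotomic) (hγ : κ.IsTopGenerator γ) (hγ' : IsCyclotomicVariable p γ)
    (hf : IsNewformOf W f) (K : DivisibilityInputs W p f κ γ I D)
    (π : D.X →ₗ[IwasawaAlgebra p] Y) (hπs : Function.Surjective π) (hπ : Function.Exact K.toX π)
    {z₀ : I.H}
    (hz : ∃ s : IwasawaAlgebra p, s ∉ (primeT p).asIdeal ∧ s • z₀ ∈ K.Z ∧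
      ∀ z ∈ K.Z, s • z ∈ Submodule.span (IwasawaAlgebra p) {z₀}) :
    lengthAt (IwasawaAlgebra p) (I.H ⧸ Submodule.span (IwasawaAlgebra p) {z₀}) (primeT p) =
      lengthAt (IwasawaAlgebra p) Y (primeT p) := by
  obtain ⟨s, hs, hsz, hsZ⟩ := hz
  -- step 3: `ℓ_T(𝐇¹_Γ/Λz₀) = ℓ_T(𝐇¹_Γ/K.Z)`
  have h3 : lengthAt (IwasawaAlgebra p) (I.H ⧸ Submodule.span (IwasawaAlgebra p) {z₀}) (primeT p) =
      lengthAt (IwasawaAlgebra p) (I.H ⧸ K.Z) (primeT p) := by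
    refine lengthAt_quotient_eq_of_localized_eq_submodule (primeT p) hs hsZ ?_
    intro x hx
    obtain ⟨a, rfl⟩ := Submodule.mem_span_singleton.mp hx
    rw [smul_comm]
    exact K.Z.smul_mem a hsz
  -- step 2: `ℓ_T(𝐇¹_Γ/K.Z) = ℓ_T(Y)` (Kato p. 280 + BCS, at `(T) ∌ p`)
  rw [h3]
  exact Kim2025.fine_offP_of_bcs hBCS hp hord hirr hκ hγ hγ' hf K π hπs hπ (primeT p)
    (height_primeT p) (Kim2025.C_natCast_not_mem_primeT p)

end Package

/-! ## §3 On the constructed `X₀(E/ℚ_∞)`, for admissible classes, at door primes (steps 1–3) -/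

section Door

variable {p : ℕ} [Fact p.Prime]

/-- At a door prime `E[p]` is irreducible (`ρ̄_{E,p}` onto; `p ≠ 0` in `ℚ`).
[cite: Serre1972, §2.4 Prop. 15 and §4] -/
theorem hasIrreducibleModPGaloisRep_of_door (W : WeierstrassCurve ℚ) [W.IsElliptic]
    (hsurj : W.HasSurjectiveModNGaloisRep p) : W.HasIrreducibleModPGaloisRep p := by
  haveI : NeZero (p : ℚ) := ⟨by exact_mod_cast (Fact.out : p.Prime).ne_zero⟩
  exact hasIrreducibleModPGaloisRep_of_hasSurjectiveModNGaloisRep W p hsurj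

/-- **`ℓ_T(𝐇¹_Γ/Λz₀) = ℓ_T(X₀(E/ℚ_∞))` for every ADMISSIBLE Kato zeta class, at a door prime, for
the cyclotomic pair in the cyclotomic variable — from BCS Thm. 1.1.2 (a) (`hBCS`, tree named fact)
and the §17.13 package with fine quotient and the admissible localisation clause (`hX`, spelled out:
Kato Thm. 12.6 + 12.5 (1)(4) + (14.9.3)/(17.13.1), the «needs X» of this input).** `X₀` is the
CONSTRUCTED `(W.fineSelmerDualData K hγ).X`; the newform is read off the admissible class ((A0) of
`AdmissibleZetaClassBody`), so no modularity fact is consumed. This is Kato's Conj. 12.10 at `(T)` in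
the fine-Selmer currency (`ℓ_T(X₀) = ℓ_T(𝐇²_Γ)` by (14.9.1) + Imai, step 4, not needed here).
[cite: Kato2004Asterisque, Conj. 12.10 (p. 224), Thm. 12.5 (1)(4) (pp. 221–222), Thm. 12.6 (p. 222), (14.9.3) (p. 240), §17.13 (pp. 279–280)]
[cite: BurungaleCastellaSkinner2025, Thm. 1.1.2 (a)] [cite: Kim2025RefinedTNC, Thm. 3.19 (§3.5.3)] -/
theorem lengthAt_quotient_span_primeT_eq_fineSelmerDual_of_inputs
    (hBCS : burungale_castella_skinner_charIdeal_eq_padicLFunction)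
    (hX : ∀ (W : WeierstrassCurve ℚ) [W.IsElliptic] [W.IsGloballyMinimal] (p : ℕ) [Fact p.Prime]
      [ContinuousSMul ℤ_[p] (W.tateModule p)] {N : ℕ} [NeZero N] (f : CuspForm (Gamma0 N) 2)
      (κ : ZpExtension ℚ p) (γ : absoluteGaloisGroup ℚ) (hκ : κ.IsCyclotomic),
      p ≠ 2 → IsOrdinaryAt W p → κ.IsTopGenerator γ → IsCyclotomicVariable p γ → IsNewformOf W f →
      ∀ (I : IwasawaH1Data W p κ γ) (D : W.SelmerDualData κ γ) (Y : W.FineSelmerDualData κ γ),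
        ∃ (K : DivisibilityInputs W p f κ γ I D) (π : D.X →ₗ[IwasawaAlgebra p] Y.X),
          Function.Surjective π ∧ Function.Exact K.toX π ∧
          (W.HasIrreducibleModPGaloisRep p → ∀ z₀ : I.H, IsAdmissibleZetaClass W p κ hκ I z₀ →
            ∀ 𝔭 : PrimeSpectrum (IwasawaAlgebra p), 𝔭.asIdeal.height = 1 →
              ∃ s : IwasawaAlgebra p, s ∉ 𝔭.asIdeal ∧ s • z₀ ∈ K.Z ∧
                ∀ z ∈ K.Z, s • z ∈ Submodule.span (IwasawaAlgebra p) {z₀}))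
    (W : WeierstrassCurve ℚ) [W.IsElliptic] [W.IsGloballyMinimal] [ContinuousSMul ℤ_[p] (W.tateModule p)]
    (h5 : 5 ≤ p) (hord : IsOrdinaryAt W p) (hsurj : W.HasSurjectiveModNGaloisRep p)
    (K : ZpExtension ℚ p) (hK : K.IsCyclotomic) (γ : absoluteGaloisGroup ℚ) (hγ : K.IsTopGenerator γ)
    (hγ' : IsCyclotomicVariable p γ) (I : IwasawaH1Data W p K γ) {z₀ : I.H}
    (hz : IsAdmissibleZetaClass W p K hK I z₀) :
    lengthAt (IwasawaAlgebra p) (I.H ⧸ Submodule.span (IwasawaAlgebra p) {z₀}) (primeT p) =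
      lengthAt (IwasawaAlgebra p) (W.fineSelmerDualData K hγ).X (primeT p) := by
  have hirr : W.HasIrreducibleModPGaloisRep p := hasIrreducibleModPGaloisRep_of_door W hsurj
  -- the newform of `W` and `p ≠ 2`, read off the admissible class ((A0) of the body)
  letI : Module.Free ℤ_[p] (W.tateModule p) := W.module_free_tateModule_holds p
  letI : Module.Finite ℤ_[p] (W.tateModule p) := W.module_finite_tateModule_holds p
  obtain ⟨hp2, N, hN, f, hf, -⟩ := (isAdmissibleZetaClass_iff W p K hK I z₀).mp hz
  -- the package with fine quotient and the admissible localisation clause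
  obtain ⟨Kp, π, hπs, hπ, hloc⟩ :=
    hX W p f K γ hK hp2 hord hγ hγ' hf I (W.selmerDualData K hγ) (W.fineSelmerDualData K hγ)
  exact lengthAt_quotient_span_primeT_eq_fine_of_bcs hBCS h5 hord hirr hK hγ hγ' hf Kp π hπs hπ
    (hloc hirr z₀ hz (primeT p) (height_primeT p))

/-- **The consumer's inequality at the cyclotomic variable, modulo `hBCS` and `hX` only** (no `𝐇²`, no
Imai): at a door prime, for the cyclotomic `K` with topological generator `γ` in the cyclotomic
variable, every pinned `I` and every admissible `z₀`, `ℓ_T(𝐇¹_Γ/Λz₀) ≤ ℓ_T(X₀(E/ℚ_∞))` — verbatim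
the conclusion of `Summit…DerivedKatoValuationDoor.zetaQuotientLengthLeFineLength_of_stub` (crux 23024,
line `lower`, the former r4/r5 stub) at such pairs; indeed `=`.
[cite: Kato2004Asterisque, Conj. 12.10 (p. 224), §17.13 (p. 280)] [cite: BurungaleCastellaSkinner2025, Thm. 1.1.2 (a)] -/
theorem zetaQuotientLength_le_fineLength_of_inputs
    (hBCS : burungale_castella_skinner_charIdeal_eq_padicLFunction)
    (hX : ∀ (W : WeierstrassCurve ℚ) [W.IsElliptic] [W.IsGloballyMinimal] (p : ℕ) [Fact p.Prime]
      [ContinuousSMul ℤ_[p] (W.tateModule p)] {N : ℕ} [NeZero N] (f : CuspForm (Gamma0 N) 2)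
      (κ : ZpExtension ℚ p) (γ : absoluteGaloisGroup ℚ) (hκ : κ.IsCyclotomic),
      p ≠ 2 → IsOrdinaryAt W p → κ.IsTopGenerator γ → IsCyclotomicVariable p γ → IsNewformOf W f →
      ∀ (I : IwasawaH1Data W p κ γ) (D : W.SelmerDualData κ γ) (Y : W.FineSelmerDualData κ γ),
        ∃ (K : DivisibilityInputs W p f κ γ I D) (π : D.X →ₗ[IwasawaAlgebra p] Y.X),
          Function.Surjective π ∧ Function.Exact K.toX π ∧
          (W.HasIrreducibleModPGaloisRep p → ∀ z₀ : I.H, IsAdmissibleZetaClass W p κ hκ I z₀ →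
            ∀ 𝔭 : PrimeSpectrum (IwasawaAlgebra p), 𝔭.asIdeal.height = 1 →
              ∃ s : IwasawaAlgebra p, s ∉ 𝔭.asIdeal ∧ s • z₀ ∈ K.Z ∧
                ∀ z ∈ K.Z, s • z ∈ Submodule.span (IwasawaAlgebra p) {z₀}))
    (W : WeierstrassCurve ℚ) [W.IsElliptic] [W.IsGloballyMinimal] [ContinuousSMul ℤ_[p] (W.tateModule p)]
    (h5 : 5 ≤ p) (hord : IsOrdinaryAt W p) (hsurj : W.HasSurjectiveModNGaloisRep p)
    (K : ZpExtension ℚ p) (hK : K.IsCyclotomic) (γ : absoluteGaloisGroup ℚ) (hγ : K.IsTopGenerator γ)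
    (hγ' : IsCyclotomicVariable p γ) (I : IwasawaH1Data W p K γ) (z₀ : I.H)
    (hz : IsAdmissibleZetaClass W p K hK I z₀) :
    lengthAt (IwasawaAlgebra p) (I.H ⧸ Submodule.span (IwasawaAlgebra p) {z₀}) (primeT p) ≤
      lengthAt (IwasawaAlgebra p) (W.fineSelmerDualData K hγ).X (primeT p) :=
  (lengthAt_quotient_span_primeT_eq_fineSelmerDual_of_inputs hBCS hX W h5 hord hsurj K hK γ hγ hγ' I
    hz).le

/-! ## §4 The conclusion of `kato_mainConjecture_primeT_of_door` at the cyclotomic variable (steps 1–4) -/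

/-- **Kato 2004 Conj. 12.10 at `𝔭 = (T)` for `T_pW` at a door prime, on Kato's `𝐇²_Γ(T_pW)` with its
Poitou–Tate embedding of `X₀(E/ℚ_∞)` — VERBATIM the conclusion of the named fact
`kato_mainConjecture_primeT_of_door`, for every door prime, every cyclotomic `K`, every topological
generator `γ` IN THE CYCLOTOMIC VARIABLE and every pinned `I`, from:** `hBCS` (BCS 2025 Thm. 1.1.2 (a),
tree named fact), `hX` (Kato's §17.13 package with fine quotient and the admissible localisation clause,
Thm. 12.6 + 12.5 (1)(4) — the typed missing clause, spelled out), `hH2` (Kato (14.9.1) + (12.2.3) +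
(17.13.1): the tree named fact `exists_iwasawaH2Data_fineSelmerDual_embedding`) and the pointwise `hfin`
(Imai 1975: `W(ℚ_{p,∞})[p^∞]` finite at the good prime `p`, in the currency of `hH2`). Proof:
`J, e` from `hH2`; for an admissible `z₀`, `ℓ_T(J.H2) = ℓ_T(X₀)` (injective with finite cokernel at the
height-one prime `(T)`) `= ℓ_T(𝐇¹_Γ/Λz₀)` (§3). The remaining distance to the named fact itself is
the change of cyclotomic pair `(K, γ) ↦` arbitrary (module docstring, (N2)); nothing about BSD is
claimed. [cite: Kato2004Asterisque, Conj. 12.10 (p. 224), §17.13 (pp. 279–280), (14.9.1) (p. 239), (14.14.1) (p. 243), Thm. 12.6 (p. 222)]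
[cite: BurungaleCastellaSkinner2025, Thm. 1.1.2 (a) (p. 2 of arXiv:2405.00270v2)]
[cite: Imai1975, Theorem (p. 12)] [cite: Kim2025RefinedTNC, Thm. 3.19 (§3.5.3)] -/
theorem kato_mainConjecture_primeT_of_door_of_isCyclotomicVariable
    (hBCS : burungale_castella_skinner_charIdeal_eq_padicLFunction)
    (hX : ∀ (W : WeierstrassCurve ℚ) [W.IsElliptic] [W.IsGloballyMinimal] (p : ℕ) [Fact p.Prime]
      [ContinuousSMul ℤ_[p] (W.tateModule p)] {N : ℕ} [NeZero N] (f : CuspForm (Gamma0 N) 2)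
      (κ : ZpExtension ℚ p) (γ : absoluteGaloisGroup ℚ) (hκ : κ.IsCyclotomic),
      p ≠ 2 → IsOrdinaryAt W p → κ.IsTopGenerator γ → IsCyclotomicVariable p γ → IsNewformOf W f →
      ∀ (I : IwasawaH1Data W p κ γ) (D : W.SelmerDualData κ γ) (Y : W.FineSelmerDualData κ γ),
        ∃ (K : DivisibilityInputs W p f κ γ I D) (π : D.X →ₗ[IwasawaAlgebra p] Y.X),
          Function.Surjective π ∧ Function.Exact K.toX π ∧
          (W.HasIrreducibleModPGaloisRep p → ∀ z₀ : I.H, IsAdmissibleZetaClass W p κ hκ I z₀ →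
            ∀ 𝔭 : PrimeSpectrum (IwasawaAlgebra p), 𝔭.asIdeal.height = 1 →
              ∃ s : IwasawaAlgebra p, s ∉ 𝔭.asIdeal ∧ s • z₀ ∈ K.Z ∧
                ∀ z ∈ K.Z, s • z ∈ Submodule.span (IwasawaAlgebra p) {z₀}))
    (hH2 : exists_iwasawaH2Data_fineSelmerDual_embedding)
    (W : WeierstrassCurve ℚ) [W.IsElliptic] [W.IsGloballyMinimal] [ContinuousSMul ℤ_[p] (W.tateModule p)]
    (h5 : 5 ≤ p) (hord : IsOrdinaryAt W p) (hsurj : W.HasSurjectiveModNGaloisRep p)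
    (K : ZpExtension ℚ p) (hK : K.IsCyclotomic) (γ : absoluteGaloisGroup ℚ) (hγ : K.IsTopGenerator γ)
    (hγ' : IsCyclotomicVariable p γ) (v : HeightOneSpectrum (𝓞 ℚ))
    (hv : ((Rat.HeightOneSpectrum.primesEquiv v : Nat.Primes) : ℕ) = p)
    (hfin : Finite (FixedPoints.addSubgroup ↥(K.kerSubgroup ⊓ GreenbergSelmer.decomp v)
      (W.geomPrimaryTorsion p)))
    (I : IwasawaH1Data W p K γ) :
    ∃ (J : IwasawaH2Data W p K γ I)
      (e : (W.fineSelmerDualData K hγ).X →ₗ[IwasawaAlgebra p] J.H2),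
      Function.Injective e ∧ Finite (J.H2 ⧸ LinearMap.range e) ∧
      ∀ z₀ : I.H, IsAdmissibleZetaClass W p K hK I z₀ →
        lengthAt (IwasawaAlgebra p) J.H2 (primeT p) =
          lengthAt (IwasawaAlgebra p) (I.H ⧸ Submodule.span (IwasawaAlgebra p) {z₀}) (primeT p) := by
  -- step 4: Kato's `𝐇²_Γ` with the Poitou–Tate embedding of `X₀` (finite cokernel by `hfin`)
  obtain ⟨J, e, he, hfin'⟩ := hH2 W p K γ hγ v (ne_two_of_five_le h5) hK hv hfin I
  refine ⟨J, e, he, hfin', fun z₀ hz ↦ ?_⟩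
  -- `ℓ_T(X₀) = ℓ_T(J.H2)` (injective with finite cokernel; `(T)` has height one)
  have hX₀ : lengthAt (IwasawaAlgebra p) (W.fineSelmerDualData K hγ).X (primeT p) =
      lengthAt (IwasawaAlgebra p) J.H2 (primeT p) :=
    lengthAt_eq_of_injective_of_finite_quotient e he hfin' (primeT p) (height_primeT p).le
  -- steps 1–3: `ℓ_T(𝐇¹_Γ/Λz₀) = ℓ_T(X₀)`
  rw [← hX₀, lengthAt_quotient_span_primeT_eq_fineSelmerDual_of_inputs hBCS hX W h5 hord hsurj K hK γ
    hγ hγ' I hz]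

end Door

end Literature.NumberTheory.EllipticCurves.Kato2004

end
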